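import Literature.IUT.HodgeArakelov.GMonoidFrobenioidsEquivalence
import Literature.IUT.HodgeTheaters.BadLocalFrobenioidBases
import Literature.AnabelianGeometry.SemiGraphs.CosetCategoriesEquivalence
import HarnessLib

/-!
# [IUTchII] Definition 3.8 (i): the model Frobenioid of a `G`-monoid is functorial OVER A CHANGE OF BASE —
# isomorphisms of PAIRS `(G ↷ Ψ) ⥲ (G' ↷ Ψ')` and inflation along an augmentation `Π ↠ G` («mono-analytic ⊆ holomorphic»)

S. Mochizuki, *Inter-universal Teichmüller theory II*, §3, kurims manuscript (Dec. 2020), Definition 3.8 (i)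
p. 112 l. 47 – p. 113 l. 57 [cite: Mochizuki2012, Def 3.8 (i) p.113] (pages = kurims preprint render
IUTchII-kurims-url-5036b4059555; D-0012 claim key, status disputed — nothing of the series is asserted): «each of the
monoids equipped with a `G_v(M^Θ_*(†F_v))`-, `Π_X(M^Θ_*)`-action … gives rise to a `p_v`-adic Frobenioid … also we
shall write `F^⊢_cns(M^Θ_*)`, `†C^⊢_v` for the mono-analytic versions [i.e. over `G_v`] … the isomorphism of monoids of
Proposition 3.3, (ii), may be interpreted as an isomorphism of Frobenioids `†C_v ⥲ F_cns(M^Θ_*)`» — there the two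
monoids carry actions of DIFFERENT groups (`G_v(M^Θ_*(†F_v))`, resp. `Π_X(M^Θ_*) ↠ G_v(M^Θ_*)`) identified by
reconstruction isomorphisms; Corollary 3.7 (i) p. 111 «each isomorphism `M^Θ_*(Π_v) ⥲ M^Θ_*(†F_v)` induces compatible
collections of isomorphisms [of monoids with group actions]».  S. Mochizuki, *Inter-universal Teichmüller theory I*,
Example 3.3 (i) pp. 77–78 «`D⊢_v` may be naturally regarded [by pulling back via `Π_v ↠ G_v`] as a full subcategory of
`D_v`» [cite: Mochizuki2012, I Ex 3.3 (i) pp.77-78].  S. Mochizuki, *The geometry of Frobenioids I*, Thm. 6.2 (i)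
p. 111 («we obtain a functor `Ψ : C₁ → C₂`» from compatible natural transformations over a base functor) and Cor. 5.4
p. 104 («the horizontal arrows are equivalences») [cite: MochizukiFrdI2008, Cor. 5.4 p.104]; *… Frobenioids II*,
Ex. 1.3 (ii) p. 11 (the pull-back functor of bases along a continuous surjection) [cite: MochizukiFrdII2008, Ex 1.3 (ii) p.11].

abc-iut cell, MERGE-MAP register row **R-Def38-a**, item «OVER-BASE / PAIR-ISO» (plan/L6/MERGE-MAP.md §8S), seat
abc-iut-L6-t7 gen 5 (the register's writer).  The gen-4 file `GMonoidFrobenioidsEquivariant` (p457393) and today's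
`GMonoidFrobenioidsEquivalence` treat `G`-EQUIVARIANT maps `Ψ → Ψ'` for ONE acting group `G` (their HONEST LIMIT
(1)).  THIS FILE is the base-changing version, CLASS (b) CONSTRUCTION over FROZEN vocabulary consumed BY NAME (nothing
re-declared): abc-iut-w4-d019's `CoveringMonoid.invariants / pull / rep / rep_spec / coe_pull_eq_act /
invariantsFunctor / divisorFunctor / ratFnFunctor / divB / frobenioid` (p455796), abc-iut-L6-t7's `trivialObj`
(p457393) and `dataHom_functor_isEquivalence_of_bijective` pattern, abc-iut-L5-t2's small base `CosetCat` with its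
pull-back functor `CosetCat.pull aug hc hs` / `pullEquiv` / `pt_pull_map` / `pull_full` / `pull_faithful` /
`pull_isEquivalence_of_injective` ([FrdII] Ex. 1.3 (ii)), abc-iut-w5-d048's `ModelFrobenioid.DataHomOver` /
`DataHomOver.functor` ([FrdI] Thm. 6.2 (i)) and abc-iut-w5-d137's `functor_faithful / functor_full /
functor_isEquivalence` ([FrdI] Cor. 5.4), abc-iut-L1's `associatesMap`, `MonGp.map`, `gpApp`.

WHAT IS CONSTRUCTED / PROVED.  Data: a continuous surjection `aug : P ↠ G` of topological groups, a `G`-monoid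
`M = (G ↷ Ψ)`, a `P`-monoid `M' = (P ↷ Ψ')` and a homomorphism `ψ : Ψ → Ψ'` that is EQUIVARIANT THROUGH `aug`:
`ψ((aug π)·x) = π·ψ(x)`.
* `CoveringMonoid.inflate aug M : CoveringMonoid P` — `Ψ` with `P` acting through `aug` (the «mono-analytic object
  regarded as a holomorphic one» direction of `D⊢_v ⊆ D_v`);
* `map_mem_invariants_over` (`x ∈ Ψ^V ⇒ ψ x ∈ Ψ'^{aug⁻¹V}`), `invariantsHomOver`, **`invariantsNatTransOver :
  Ψ^{(-)} ⟶ (pull aug)^op ⋙ Ψ'^{(-)}`** — naturality with respect to the pull-backs of [FrdI] Def 1.1 (ii) shape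
  (PROVED: the pull-back along `G/U → G/V` is the action of a representative `a`; along the pulled-back map it is the
  action of ANY lift `π₀`, `aug π₀ = a`); `divisorNatTransOver` (classes), **`dataHomOverOfEquivariant :
  ModelFrobenioid.DataHomOver (CosetCat.pull aug hc hs) M.divB M'.divB`** (the square `Div_B' ∘ ψ^gp = η^gp ∘ Div_B`
  PROVED) and **`frobenioidMapOver : F(G ↷ Ψ) ⥤ F(P ↷ Ψ')`**, which lies over `pull aug : 𝓑(G)⁰ → 𝓑(P)⁰` ON THE NOSE
  (`frobenioidMapOver_comp_baseFunctor`, `rfl`);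
* when `ψ` is BIJECTIVE: `invariantsHomOver_bijective`, `etaOver_app_bijective`, `betaOver_app_bijective`,
  **`frobenioidMapOver_faithful`, `frobenioidMapOver_full`** (over the FULLY FAITHFUL `pull aug`); when moreover `aug`
  is injective and open (an isomorphism of topological groups): **`frobenioidMapOver_isEquivalence`**;
* §3 (a) **ISOMORPHISMS OF PAIRS**: for `σ : G ≃ₜ* G'` and `ψ : Ψ ≃* Ψ'` with `ψ(g·x) = σ(g)·ψ(x)` —
  `frobenioidMapOfPairIso σ ψ : F(G ↷ Ψ) ⥤ F(G' ↷ Ψ')` over the induced equivalence `𝓑(G)⁰ ≌ 𝓑(G')⁰`,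
  **`frobenioidMapOfPairIso_isEquivalence`** (so `(frobenioidMapOfPairIso σ ψ).asEquivalence : F(G ↷ Ψ) ≌ F(G' ↷ Ψ')`;
  the bare `Nonempty (≌)` corollary is not restated — the gate identifies it with p466730's) — the print-faithful form of
  «the isomorphism of monoids [with group actions] … may be interpreted as an isomorphism of Frobenioids»;
  (b) **INFLATION** along `aug`: `frobenioidInflate aug M : F(G ↷ Ψ) ⥤ F(P ↷ Ψ|_aug)`, FULLY FAITHFUL
  (`frobenioidInflate_faithful / _full`) — the `G`-monoid-level form of «`†C^⊢_v`, `F^⊢_cns(M^Θ_*)` for the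
  mono-analytic versions» / [IUTchI] Ex. 3.3 (i) «`D⊢_v ⊆ D_v` a full subcategory» (abc-iut-L5-t2's field-level
  `GoodLocalKit.baseChangeCv` is the twin on the [IUTchI] side); (c) at abc-iut-L5-t2's bad-place base datum
  `T : BadLocalGroupDatum G_v Π_v` the inflation lies over `T.incl : D⊢_v ⥤ D_v` on the nose and is fully faithful.
HONEST LIMITS: (1) the reconstruction isomorphisms that IDENTIFY the groups in print (e.g. `G_v(M^Θ_*(†F_v)) ≅ G_v`)
are INPUTS `σ` here, not produced; (2) no identification of `F_cns` with the field-level Frobenioids at the genuine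
producers (MERGE-MAP B16); (3) `inflate` along a non-injective `aug` is fully faithful, not an equivalence (the
holomorphic base has more objects).  No `instance`, no `Prop`-valued definition, no notation, no sorry; typed ≠
proved elsewhere; nothing here bears on [IUTchIII] Cor. 3.12; nothing asserts abc proved or refuted.
-/

noncomputable section

namespace Literature.IUT.HodgeArakelov

open CategoryTheory Opposite Function
open Literature.AlgebraicGeometry.Frobenioids Literature.AnabelianGeometry.SemiGraphs

universe u v

namespace CoveringMonoid

variable {G : Type u} [Group G] [TopologicalSpace G] {P : Type u} [Group P] [TopologicalSpace P]
  (aug : P →* G) (hc : Continuous aug) (hs : Surjective aug)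

/-! ### 1. Inflation of a `G`-monoid along `aug : P → G` -/

omit [TopologicalSpace G] [TopologicalSpace P] in
/-- **Inflation**: the `G`-monoid `G ↷ Ψ` regarded as a `P`-monoid through `aug : P → G` (`π·x := (aug π)·x`) — the
`G`-monoid-level form of regarding a mono-analytic object over `G_v` as a holomorphic one over `Π_v ↠ G_v` ([IUTchI]
Ex. 3.3 (i) `D⊢_v ⊆ D_v`; [IUTchII] Def 3.8 (i) «mono-analytic versions»). [cite: Mochizuki2012, Def 3.8 (i) p.113] -/
def inflate (M : CoveringMonoid.{u, v} G) : CoveringMonoid.{u, v} P where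
  O := M.O
  act := M.act.comp aug

omit [TopologicalSpace G] [TopologicalSpace P] in
/-- The action of the inflation is the action through `aug`. [cite: Mochizuki2012, Def 3.8 (i) p.113] -/
@[simp] theorem inflate_act (M : CoveringMonoid.{u, v} G) (π : P) (x : M.O) :
    (M.inflate aug).act π x = M.act (aug π) x := rfl

/-! ### 2. Homomorphisms equivariant THROUGH `aug`: invariants and the induced morphism of monoids over `pull aug` -/

section Over

variable {aug} {M : CoveringMonoid.{u, v} G} {M' : CoveringMonoid.{u, v} P} (ψ : M.O →* M'.O)
  (hψ : ∀ (π : P) (x : M.O), ψ (M.act (aug π) x) = M'.act π (ψ x))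

omit [TopologicalSpace G] [TopologicalSpace P] in
include hψ in
/-- A homomorphism equivariant through `aug` carries `V`-invariants to `aug⁻¹V`-invariants.
[cite: Mochizuki2012, Def 3.8 (i) p.113] -/
theorem map_mem_invariants_comap {V : Subgroup G} {x : M.O} (hx : x ∈ M.invariants V) :
    ψ x ∈ M'.invariants (V.comap aug) :=
  fun π hπ => by rw [← hψ, hx (aug π) hπ]

include hψ in
/-- … in the typing of the pull-back functor of bases: `x ∈ Ψ^V ⇒ ψ x ∈ Ψ'^{(pull aug)(G/V)}`.
[cite: MochizukiFrdII2008, Ex 1.3 (ii) p.11] -/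
theorem map_mem_invariants_over (X : CosetCat G) {x : M.O} (hx : x ∈ M.invariants (X.sg : Subgroup G)) :
    ψ x ∈ M'.invariants (((CosetCat.pull aug hc hs).obj X).sg : Subgroup P) :=
  fun π hπ => by
    have hπ' : aug π ∈ X.sg := (OpenSubgroup.mem_comap (hf := hc)).mp hπ
    rw [← hψ, hx (aug π) hπ']

/-- The restriction `Ψ^V → Ψ'^{aug⁻¹V}` of a homomorphism equivariant through `aug`. [cite: Mochizuki2012, Def 3.8 (i) p.113] -/
def invariantsHomOver (X : CosetCat G) :
    M.invariants (X.sg : Subgroup G) →* M'.invariants (((CosetCat.pull aug hc hs).obj X).sg : Subgroup P) :=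
  (ψ.restrict (M.invariants (X.sg : Subgroup G))).codRestrict _ fun x => map_mem_invariants_over hc hs ψ hψ X x.2

/-- Values of `invariantsHomOver`. [cite: Mochizuki2012, Def 3.8 (i) p.113] -/
@[simp] theorem invariantsHomOver_coe (X : CosetCat G) (x : M.invariants (X.sg : Subgroup G)) :
    (invariantsHomOver hc hs ψ hψ X x : M'.O) = ψ x := rfl

/-- A lift `π₀` of the chosen representative `rep f` of `pt f` represents the point of the pulled-back map
`(pull aug).map f`. [cite: MochizukiFrdII2008, Ex 1.3 (ii) p.11] -/
theorem coe_lift_eq_pt_pull_map {X Y : CosetCat G} (f : X ⟶ Y) {π₀ : P} (h : aug π₀ = rep f) :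
    ((π₀ : P) : ((CosetCat.pull aug hc hs).obj Y).carrier) = CosetCat.pt ((CosetCat.pull aug hc hs).map f) := by
  rw [CosetCat.pt_pull_map, eq_comm, Equiv.symm_apply_eq, CosetCat.pullEquiv_coe, h, rep_spec]

/-- **The morphism of monoids over `pull aug` induced by a homomorphism equivariant through `aug`**,
`Ψ^{(-)} ⟶ (pull aug)^op ⋙ Ψ'^{(-)}`: naturality with respect to the pull-backs ([FrdI] Def 1.1 (ii) shape) PROVED —
along `f : G/U → G/V` the pull-back is the action of the representative `rep f`, along `(pull aug) f` it is the
action of any lift `π₀` of it, and `ψ((aug π₀)·x) = π₀·ψ(x)`. [cite: MochizukiFrdI2008, Thm. 6.2 (i) p.111] -/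
def invariantsNatTransOver : M.invariantsFunctor ⟶ (CosetCat.pull aug hc hs).op ⋙ M'.invariantsFunctor where
  app X := CommMonCat.ofHom (invariantsHomOver hc hs ψ hψ (unop X))
  naturality X Y f := by
    apply CommMonCat.hom_ext
    apply MonoidHom.ext
    intro x
    apply Subtype.ext
    obtain ⟨π₀, hπ₀⟩ := hs (rep f.unop)
    change ψ (M.act (rep f.unop) (Subtype.val x)) =
      Subtype.val (M'.pull ((CosetCat.pull aug hc hs).map f.unop) (invariantsHomOver hc hs ψ hψ (unop X) x))
    rw [M'.coe_pull_eq_act ((CosetCat.pull aug hc hs).map f.unop) (coe_lift_eq_pt_pull_map hc hs f.unop hπ₀),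
      ← hπ₀, hψ]
    rfl

/-- Components of `invariantsNatTransOver`. [cite: MochizukiFrdI2008, Thm. 6.2 (i) p.111] -/
theorem invariantsNatTransOver_app (X : (CosetCat G)ᵒᵖ) :
    ((invariantsNatTransOver hc hs ψ hψ).app X).hom = invariantsHomOver hc hs ψ hψ (unop X) := rfl

/-- The induced morphism of divisor monoids over `pull aug`, `Φ ⟶ (pull aug)^op ⋙ Φ'` (classes to classes).
[cite: MochizukiFrdI2008, Thm. 6.2 (i) p.111] -/
def divisorNatTransOver : M.divisorFunctor ⟶ (CosetCat.pull aug hc hs).op ⋙ M'.divisorFunctor where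
  app X := CommMonCat.ofHom (associatesMap ((invariantsNatTransOver hc hs ψ hψ).app X).hom)
  naturality X Y f := by
    apply CommMonCat.hom_ext
    apply MonoidHom.ext
    intro x
    obtain ⟨a, rfl⟩ := Associates.mk_surjective x
    exact congrArg Associates.mk
      (congrArg (fun h => (CommMonCat.Hom.hom h) a) ((invariantsNatTransOver hc hs ψ hψ).naturality f))

/-- Components of `divisorNatTransOver` on classes. [cite: MochizukiFrdI2008, Thm. 6.2 (i) p.111] -/
theorem divisorNatTransOver_app_mk (X : (CosetCat G)ᵒᵖ) (x : M.invariants ((unop X).sg : Subgroup G)) :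
    ((divisorNatTransOver hc hs ψ hψ).app X).hom (Associates.mk x) =
      Associates.mk (invariantsHomOver hc hs ψ hψ _ x) := rfl

/-- **The morphism of model data OVER `pull aug`** induced by `ψ`: `η` = classes of `ψ`, `β = ψ^gp` on invariants,
and the square `Div_B'|_{pull} ∘ β = η^gp ∘ Div_B` commutes (both paths are the groupification of `x ↦ [ψ x]`; PROVED)
— abc-iut-w5-d048's `DataHomOver` ([FrdI] Thm. 6.2 (i) «compatible natural transformations `Φ₁ → Φ₂|_{D₁}`,
`B₁ → B₂|_{D₁}`»). [cite: MochizukiFrdI2008, Thm. 6.2 (i) p.111] -/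
def dataHomOverOfEquivariant : ModelFrobenioid.DataHomOver (CosetCat.pull aug hc hs) M.divB M'.divB where
  η := divisorNatTransOver hc hs ψ hψ
  β := Functor.whiskerRight (invariantsNatTransOver hc hs ψ hψ) MonGp.functor
  comm A u := by
    have key : (gpApp (divisorNatTransOver hc hs ψ hψ) A).comp
          (AlgebraicGeometry.Frobenioids.divB _ _ M.divB A) =
        (AlgebraicGeometry.Frobenioids.divB _ _
            (ModelFrobenioid.divBRestrict (CosetCat.pull aug hc hs) M'.divisorFunctor M'.ratFnFunctor M'.divB) A).comp
          ((Functor.whiskerRight (invariantsNatTransOver hc hs ψ hψ) MonGp.functor).app A).hom := by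
      change (MonGp.map (associatesMap (invariantsHomOver hc hs ψ hψ (unop A)))).comp
          (MonGp.map (Associates.mkMonoidHom : M.invariants ((unop A).sg : Subgroup G) →* _)) =
        (MonGp.map (Associates.mkMonoidHom :
            M'.invariants (((CosetCat.pull aug hc hs).obj (unop A)).sg : Subgroup P) →* _)).comp
          (MonGp.map (invariantsHomOver hc hs ψ hψ (unop A)))
      rw [← MonGp.map_comp, ← MonGp.map_comp]
      exact congrArg MonGp.map (MonoidHom.ext fun x => rfl)
    exact DFunLike.congr_fun key u

/-- **The functor of model Frobenioids over the base change `pull aug`** induced by a homomorphism equivariant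
through `aug`: `F(G ↷ Ψ) ⥤ F(P ↷ Ψ')`, `(G/U, α) ↦ (P/aug⁻¹U, η^gp α)`, `(d, f, Div, u) ↦ (d, (pull aug) f, η Div, ψ^gp u)`
(abc-iut-w5-d048's `DataHomOver.functor`, [FrdI] Thm. 6.2 (i) «we obtain a functor `Ψ : C₁ → C₂`»).
[cite: Mochizuki2012, Def 3.8 (i) p.113] -/
def frobenioidMapOver : M.frobenioid ⥤ M'.frobenioid := (dataHomOverOfEquivariant hc hs ψ hψ).functor

/-- `frobenioidMapOver` lies over the base change `pull aug : 𝓑(G)⁰ → 𝓑(P)⁰` ON THE NOSE.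
[cite: MochizukiFrdI2008, Thm. 6.2 (i) p.110] -/
theorem frobenioidMapOver_comp_baseFunctor :
    frobenioidMapOver hc hs ψ hψ ⋙ ModelFrobenioid.baseFunctor M'.divisorFunctor M'.ratFnFunctor M'.divB =
      ModelFrobenioid.baseFunctor M.divisorFunctor M.ratFnFunctor M.divB ⋙ CosetCat.pull aug hc hs := rfl

/-- On objects: the base of the image of `X` is `(pull aug) X.base`. [cite: MochizukiFrdI2008, Thm. 6.2 (i) p.110] -/
theorem frobenioidMapOver_obj_base (X : M.frobenioid) :
    ((frobenioidMapOver hc hs ψ hψ).obj X).base = (CosetCat.pull aug hc hs).obj X.base := rfl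

/-- `frobenioidMapOver` carries the Frobenius-trivial object over `G/U` to the one over `P/aug⁻¹U`.
[cite: Mochizuki2012, Def 3.8 (i) p.113] -/
theorem frobenioidMapOver_obj_trivialObj (X : CosetCat G) :
    (frobenioidMapOver hc hs ψ hψ).obj (M.trivialObj X) = M'.trivialObj ((CosetCat.pull aug hc hs).obj X) := by
  change (⟨(CosetCat.pull aug hc hs).obj X, gpApp (divisorNatTransOver hc hs ψ hψ) (op X) 1⟩ : M'.frobenioid) =
    ⟨(CosetCat.pull aug hc hs).obj X, 1⟩
  rw [map_one]
  rfl

/-- `frobenioidMapOver` preserves Frobenius degrees. [cite: MochizukiFrdI2008, Thm. 6.2 (i) p.110] -/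
theorem degFr_frobenioidMapOver_map {X Y : M.frobenioid} (f : X ⟶ Y) :
    ModelFrobenioid.degFr ((frobenioidMapOver hc hs ψ hψ).map f) = ModelFrobenioid.degFr f := rfl

/-- The base maps of `frobenioidMapOver` are the pulled-back base maps. [cite: MochizukiFrdI2008, Thm. 6.2 (i) p.110] -/
theorem baseMap_frobenioidMapOver_map {X Y : M.frobenioid} (f : X ⟶ Y) :
    ModelFrobenioid.baseMap ((frobenioidMapOver hc hs ψ hψ).map f) =
      (CosetCat.pull aug hc hs).map (ModelFrobenioid.baseMap f) := rfl

/-! ### When `ψ` is bijective: fully faithful; over an isomorphism of groups: an equivalence -/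

/-- On invariants an injective `ψ` stays injective. [cite: Mochizuki2012, Def 3.8 (i) p.113] -/
theorem invariantsHomOver_injective (hinj : Injective ψ) (X : CosetCat G) :
    Injective (invariantsHomOver hc hs ψ hψ X) := by
  intro x y h
  apply Subtype.ext
  exact hinj (congrArg Subtype.val h)

include hs in
/-- On invariants a bijective `ψ` equivariant through the SURJECTION `aug` is surjective, `Ψ^V ↠ Ψ'^{aug⁻¹V}`: the
preimage of an `aug⁻¹V`-invariant is `V`-invariant since every `v ∈ V` lifts to `aug⁻¹V`.
[cite: Mochizuki2012, Def 3.8 (i) p.113] -/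
theorem invariantsHomOver_surjective (hb : Bijective ψ) (X : CosetCat G) :
    Surjective (invariantsHomOver hc hs ψ hψ X) := by
  intro y
  obtain ⟨x, hx⟩ := hb.2 (y : M'.O)
  refine ⟨⟨x, fun v hv => ?_⟩, Subtype.ext hx⟩
  obtain ⟨π, rfl⟩ := hs v
  apply hb.1
  rw [hψ, hx]
  exact y.2 π ((OpenSubgroup.mem_comap (hf := hc)).mpr hv)

/-- … hence bijective, `Ψ^V ≃ Ψ'^{aug⁻¹V}`. [cite: Mochizuki2012, Def 3.8 (i) p.113] -/
theorem invariantsHomOver_bijective (hb : Bijective ψ) (X : CosetCat G) :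
    Bijective (invariantsHomOver hc hs ψ hψ X) :=
  ⟨invariantsHomOver_injective hc hs ψ hψ hb.1 X, invariantsHomOver_surjective hc hs ψ hψ hb X⟩

/-- For bijective `ψ` the divisor-monoid components `η_{G/U} : Ψ^U/(Ψ^U)^× → Ψ'^{aug⁻¹U}/(Ψ'^{aug⁻¹U})^×` are
bijective. [cite: MochizukiFrdI2008, Cor. 5.4 p.104] -/
theorem etaOver_app_bijective (hb : Bijective ψ) (X : CosetCat G) :
    Bijective ((dataHomOverOfEquivariant hc hs ψ hψ).η.app (op X)).hom :=
  ⟨associatesMap_injective_of_bijective (invariantsHomOver_bijective hc hs ψ hψ hb X),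
    associatesMap_surjective (invariantsHomOver_surjective hc hs ψ hψ hb X)⟩

/-- For bijective `ψ` the rational-function-monoid components `β_{G/U} : (Ψ^U)^gp → (Ψ'^{aug⁻¹U})^gp` are bijective.
[cite: MochizukiFrdI2008, Cor. 5.4 p.104] -/
theorem betaOver_app_bijective (hb : Bijective ψ) (X : CosetCat G) :
    Bijective ((dataHomOverOfEquivariant hc hs ψ hψ).β.app (op X)).hom :=
  gpMap_bijective_of_bijective _ (invariantsHomOver_bijective hc hs ψ hψ hb X)

/-- **For bijective `ψ` the functor over `pull aug` is FAITHFUL** (`pull aug` is faithful, abc-iut-L5-t2; [FrdI]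
Cor. 5.4 criterion, abc-iut-w5-d137). [cite: MochizukiFrdI2008, Cor. 5.4 p.104] -/
theorem frobenioidMapOver_faithful (hb : Bijective ψ) : (frobenioidMapOver hc hs ψ hψ).Faithful :=
  haveI := CosetCat.pull_faithful aug hc hs
  (dataHomOverOfEquivariant hc hs ψ hψ).functor_faithful (fun X => (etaOver_app_bijective hc hs ψ hψ hb X).1)
    fun X => (betaOver_app_bijective hc hs ψ hψ hb X).1

/-- **For bijective `ψ` the functor over `pull aug` is FULL** (`pull aug` is full along a surjection — [IUTchI] Ex. 3.3
(i) «`D⊢_v ⊆ D_v` a full subcategory», abc-iut-L5-t2). [cite: Mochizuki2012, I Ex 3.3 (i) pp.77-78] -/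
theorem frobenioidMapOver_full (hb : Bijective ψ) : (frobenioidMapOver hc hs ψ hψ).Full :=
  haveI := CosetCat.pull_full aug hc hs
  (dataHomOverOfEquivariant hc hs ψ hψ).functor_full (etaOver_app_bijective hc hs ψ hψ hb)
    fun X => (betaOver_app_bijective hc hs ψ hψ hb X).2

/-- **Over an ISOMORPHISM of topological groups (`aug` also injective and open) and for bijective `ψ`, the functor
of model Frobenioids is an EQUIVALENCE of categories** ([FrdI] Cor. 5.4 «the horizontal arrows are equivalences»,
abc-iut-w5-d137, over abc-iut-L5-t2's equivalence of bases `pull_isEquivalence_of_injective`).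
[cite: MochizukiFrdI2008, Cor. 5.4 p.104] -/
theorem frobenioidMapOver_isEquivalence (hb : Bijective ψ) (hi : Injective aug) (ho : IsOpenMap aug) :
    (frobenioidMapOver hc hs ψ hψ).IsEquivalence :=
  haveI := CosetCat.pull_isEquivalence_of_injective aug hc hs hi ho
  (dataHomOverOfEquivariant hc hs ψ hψ).functor_isEquivalence (etaOver_app_bijective hc hs ψ hψ hb)
    (betaOver_app_bijective hc hs ψ hψ hb)

end Over

/-! ### 3 (a). Isomorphisms of PAIRS `(G ↷ Ψ) ⥲ (G' ↷ Ψ')` over an isomorphism of topological groups -/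

section PairIso

variable {G' : Type u} [Group G'] [TopologicalSpace G'] {M : CoveringMonoid.{u, v} G} {M' : CoveringMonoid.{u, v} G'}
  (σ : G ≃ₜ* G') (ψ : M.O ≃* M'.O) (hψ : ∀ (g : G) (x : M.O), ψ (M.act g x) = M'.act (σ g) (ψ x))

include hψ in
/-- An isomorphism of pairs is equivariant through `σ⁻¹ : G' → G` in the sense of §2. [cite: Mochizuki2012, Def 3.8 (i) p.113] -/
theorem pairIso_equivariant_symm (π : G') (x : M.O) :
    (ψ : M.O →* M'.O) (M.act (σ.symm.toMonoidHom π) x) = M'.act π ((ψ : M.O →* M'.O) x) := by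
  change ψ (M.act (σ.symm π) x) = M'.act π (ψ x)
  rw [hψ, ContinuousMulEquiv.apply_symm_apply]

/-- **The functor of Frobenioids induced by an isomorphism of pairs** `(σ, ψ) : (G ↷ Ψ) ⥲ (G' ↷ Ψ')`,
`F(G ↷ Ψ) ⥤ F(G' ↷ Ψ')`, over the equivalence of bases `𝓑(G)⁰ ≌ 𝓑(G')⁰`, `G/U ↦ G'/σ(U)` (= `pull σ⁻¹`) — the
print-faithful reading of Def 3.8 (i) «the isomorphism of monoids [with their group actions] of Proposition 3.3,
(ii), may be interpreted as an isomorphism of Frobenioids `†C_v ⥲ F_cns(M^Θ_*)`» and of Cor 3.7 (i)'s induced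
isomorphisms, at the `G`-monoid level. [cite: Mochizuki2012, Def 3.8 (i) p.113] -/
def frobenioidMapOfPairIso : M.frobenioid ⥤ M'.frobenioid :=
  frobenioidMapOver (aug := σ.symm.toMonoidHom) σ.symm.continuous σ.symm.surjective (ψ : M.O →* M'.O)
    (pairIso_equivariant_symm σ ψ hψ)

/-- The functor of an isomorphism of pairs lies over `pull σ⁻¹ : 𝓑(G)⁰ → 𝓑(G')⁰` on the nose.
[cite: Mochizuki2012, Def 3.8 (i) p.113] -/
theorem frobenioidMapOfPairIso_comp_baseFunctor :
    frobenioidMapOfPairIso σ ψ hψ ⋙ ModelFrobenioid.baseFunctor M'.divisorFunctor M'.ratFnFunctor M'.divB =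
      ModelFrobenioid.baseFunctor M.divisorFunctor M.ratFnFunctor M.divB ⋙
        CosetCat.pull σ.symm.toMonoidHom σ.symm.continuous σ.symm.surjective := rfl

/-- **An isomorphism of pairs induces an EQUIVALENCE of model Frobenioids** (inverse laws included).
[cite: Mochizuki2012, Def 3.8 (i) p.113] -/
theorem frobenioidMapOfPairIso_isEquivalence : (frobenioidMapOfPairIso σ ψ hψ).IsEquivalence :=
  frobenioidMapOver_isEquivalence σ.symm.continuous σ.symm.surjective (ψ : M.O →* M'.O)
    (pairIso_equivariant_symm σ ψ hψ) ψ.bijective σ.symm.injective σ.symm.toHomeomorph.isOpenMap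

end PairIso

/-! ### 3 (b). Inflation along an augmentation: «mono-analytic ⊆ holomorphic» is fully faithful -/

section Inflation

variable (M : CoveringMonoid.{u, v} G)

/-- **The inflation functor** `F(G ↷ Ψ) ⥤ F(P ↷ Ψ|_aug)` along a continuous surjection `aug : P ↠ G` — the identity on
monoids, the pull-back `𝓑(G)⁰ → 𝓑(P)⁰` on bases: the `G`-monoid-level form of regarding the mono-analytic
`†C^⊢_v` / `F^⊢_cns` (over `G_v`) inside the holomorphic `†C_v` / `F_cns` (over `Π_v ↠ G_v`) ([IUTchI] Ex. 3.3 (i);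
[IUTchII] Def 3.8 (i) «mono-analytic versions»). [cite: Mochizuki2012, Def 3.8 (i) p.113] -/
def frobenioidInflate : M.frobenioid ⥤ (M.inflate aug).frobenioid :=
  frobenioidMapOver (M' := M.inflate aug) hc hs (MonoidHom.id M.O) fun _ _ => rfl

/-- The inflation functor lies over `pull aug` on the nose. [cite: Mochizuki2012, I Ex 3.3 (i) pp.77-78] -/
theorem frobenioidInflate_comp_baseFunctor :
    frobenioidInflate aug hc hs M ⋙ ModelFrobenioid.baseFunctor (M.inflate aug).divisorFunctor
        (M.inflate aug).ratFnFunctor (M.inflate aug).divB =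
      ModelFrobenioid.baseFunctor M.divisorFunctor M.ratFnFunctor M.divB ⋙ CosetCat.pull aug hc hs := rfl

/-- **The inflation functor is faithful.** [cite: Mochizuki2012, I Ex 3.3 (i) pp.77-78] -/
theorem frobenioidInflate_faithful : (frobenioidInflate aug hc hs M).Faithful :=
  frobenioidMapOver_faithful (M' := M.inflate aug) hc hs (MonoidHom.id M.O) (fun _ _ => rfl) bijective_id

/-- **The inflation functor is full** — «`D⊢_v` may be naturally regarded as a full subcategory of `D_v`» lifts to the
model Frobenioids of `G`-monoids. [cite: Mochizuki2012, I Ex 3.3 (i) pp.77-78] -/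
theorem frobenioidInflate_full : (frobenioidInflate aug hc hs M).Full :=
  frobenioidMapOver_full (M' := M.inflate aug) hc hs (MonoidHom.id M.O) (fun _ _ => rfl) bijective_id

/-- Along an isomorphism of topological groups the inflation functor is an equivalence.
[cite: MochizukiFrdII2008, Ex 1.3 (ii) p.11] -/
theorem frobenioidInflate_isEquivalence (hi : Injective aug) (ho : IsOpenMap aug) :
    (frobenioidInflate aug hc hs M).IsEquivalence :=
  frobenioidMapOver_isEquivalence (M' := M.inflate aug) hc hs (MonoidHom.id M.O) (fun _ _ => rfl) bijective_id hi ho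

end Inflation

/-! ### 3 (c). At abc-iut-L5-t2's bad-place base datum `T : BadLocalGroupDatum G_v Π_v` ([IUTchI] Ex. 3.2): the
inclusion `D⊢_v ⊆ D_v` (`T.incl`) lifts to the model Frobenioids of every `G_v`-monoid -/

section BadPlace

variable (T : HodgeTheaters.BadLocalGroupDatum G P) (M : CoveringMonoid.{u, v} G)

/-- At a bad-place base datum (augmentation `Π_v ↠ G_v` with `Π_Ÿ`), the inflation functor of a `G_v`-monoid lies over
abc-iut-L5-t2's inclusion of bases `T.incl : D⊢_v ⥤ D_v` ON THE NOSE. [cite: Mochizuki2012, I Ex 3.3 (i) pp.77-78] -/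
theorem frobenioidInflate_comp_baseFunctor_eq_incl :
    frobenioidInflate T.aug T.continuous_aug T.surjective_aug M ⋙ ModelFrobenioid.baseFunctor
        (M.inflate T.aug).divisorFunctor (M.inflate T.aug).ratFnFunctor (M.inflate T.aug).divB =
      ModelFrobenioid.baseFunctor M.divisorFunctor M.ratFnFunctor M.divB ⋙ T.incl := rfl

/-- … and is fully faithful. [cite: Mochizuki2012, I Ex 3.3 (i) pp.77-78] -/
theorem frobenioidInflate_badPlace_full_faithful :
    (frobenioidInflate T.aug T.continuous_aug T.surjective_aug M).Full ∧
      (frobenioidInflate T.aug T.continuous_aug T.surjective_aug M).Faithful :=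
  ⟨frobenioidInflate_full T.aug T.continuous_aug T.surjective_aug M,
    frobenioidInflate_faithful T.aug T.continuous_aug T.surjective_aug M⟩

end BadPlace

end CoveringMonoid

end Literature.IUT.HodgeArakelov

end
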